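import Mathlib
import Literature.Probability.LatticeModels.TorusFourHypercube
import Summits.HubbardSuperconductivity.HubbardSuperconductivity.Theorems.LevyLogBootstrapBlock2InfDivXXZFourDataA
import Summits.HubbardSuperconductivity.HubbardSuperconductivity.Theorems.LevyLogBootstrapBlock2InfDivXXZFourDataT

/-!
# Crux `Block2InfDivXXZ` (stmt-HubbardSuperconductivity-15048), `M = 4` slice: the kernel checks,
# part A (orbit table and static tables)

Computable definitions only (Boolean checks run by `decide +kernel` in the `…FourFacts*` files;
soundness in `…FourTableSound`, `…FourAction`, `…FourObs`).

* Keys as bit lists (`bits`, `bitListsPop`, `keys8Bits`), colexicographic ranks (`rankBits`), the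
  packed class/witness table (`entryAt` on `witnessTab`), the two generators of `Aut(Q₄)` and the
  words evaluating to the `384` witnesses (`genAt`, `evalWord`, `gtabAt`), pull-backs `pullBits`, the
  class map `clsBits`, and the three table checks `tableCheckWords`, `tableCheckGlobal`,
  `tableCheckRange lo hi` (every half-filled key is the pull-back of its class representative along
  its witness; the class map is invariant under the generators).
* Orbit algebra: the vertex numbering `vsite`/`vidx` of the `4 × 4` torus by Gray codes, the bonds
  `edgesQ4`, and `hopCount`, `diagSum`, `raiseLowerCount` recomputing the shipped tables `hopTab`,
  `diag4`, `tTab h` from the representatives (`staticCheckHop`, `staticCheckT`, `rowCheckT`).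
-/

set_option linter.dupNamespace false

namespace Summit.HubbardSuperconductivity.HubbardSuperconductivity.Theorems.LevyLogBootstrap

noncomputable section

namespace FourCert

open Finset Literature.Probability.LatticeModels Literature.Probability.LatticeModels.TorusFour

/-! ### Keys as bit lists, ranks, packed tables

Kernel cost model (measured): an arithmetic operation on numerals costs ~10⁻⁴ s in the kernel, a
list operation ~10⁻⁵ s; so keys are handled as LISTS of `16` bits (`0`/`1`, least significant = Gray
vertex `0` first) and arithmetic is reserved for table addressing. -/

/-- Bit `v` of `k` as a natural (`0` or `1`). -/
def bit (k v : ℕ) : ℕ := k / 2 ^ v % 2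

/-- The `16` bits of a key, least significant first. -/
def bits (k : ℕ) : List ℕ := (List.range 16).map (bit k)

/-- All bit lists of length `nb` with exactly `w` ones, in increasing order of the keys they
represent (colexicographic): first those with top bit `0`, then top bit `1`. -/
def bitListsPop : ℕ → ℕ → List (List ℕ)
  | 0, 0 => [[]]
  | 0, _ + 1 => []
  | nb + 1, 0 => [List.replicate (nb + 1) 0]
  | nb + 1, w + 1 =>
    (bitListsPop nb (w + 1)).map (· ++ [0]) ++ (bitListsPop nb w).map (· ++ [1])

/-- The `12 870` half-filled keys as bit lists, in increasing order. -/
def keys8Bits : List (List ℕ) := bitListsPop 16 8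

/-- Binomial coefficients `C(n, k)`, `n < 16`, `k < 10` (a table: `Nat.choose` unfolds by Pascal's
rule, exponentially, in the kernel). -/
def chooseTab : List (List ℕ) :=
  [[1, 0, 0, 0, 0, 0, 0, 0, 0, 0],
   [1, 1, 0, 0, 0, 0, 0, 0, 0, 0],
   [1, 2, 1, 0, 0, 0, 0, 0, 0, 0],
   [1, 3, 3, 1, 0, 0, 0, 0, 0, 0],
   [1, 4, 6, 4, 1, 0, 0, 0, 0, 0],
   [1, 5, 10, 10, 5, 1, 0, 0, 0, 0],
   [1, 6, 15, 20, 15, 6, 1, 0, 0, 0],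
   [1, 7, 21, 35, 35, 21, 7, 1, 0, 0],
   [1, 8, 28, 56, 70, 56, 28, 8, 1, 0],
   [1, 9, 36, 84, 126, 126, 84, 36, 9, 1],
   [1, 10, 45, 120, 210, 252, 210, 120, 45, 10],
   [1, 11, 55, 165, 330, 462, 462, 330, 165, 55],
   [1, 12, 66, 220, 495, 792, 924, 792, 495, 220],
   [1, 13, 78, 286, 715, 1287, 1716, 1716, 1287, 715],
   [1, 14, 91, 364, 1001, 2002, 3003, 3432, 3003, 2002],
   [1, 15, 105, 455, 1365, 3003, 5005, 6435, 6435, 5005]]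

/-- Colexicographic rank from a bit list: `Σ_i C(b_i, i)` over the positions `b_1 < b_2 < …` of the
ones (combinatorial number system); for popcount-`8` lists this is the index in `keys8Bits`. -/
def rankBits (bs : List ℕ) : ℕ :=
  (bs.zipIdx.filter fun p => p.1 = 1).zipIdx.foldl (fun acc q =>
    acc + (chooseTab.getD q.1.2 []).getD (q.2 + 1) 0) 0

/-- The `r`-th entry `cls + 128·gidx` of the nested witness table. -/
def entryAt (r : ℕ) : ℕ :=
  (((witnessTab.getD (r / 1000) []).getD (r / 100 % 10) []).getD (r / 10 % 10) []).getD (r % 10) 0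

/-- Class (orbit index) of a half-filled bit list, read from the witness table. -/
def clsBits (bs : List ℕ) : ℕ := entryAt (rankBits bs) % 128

/-- Pull-back of a bit list along a vertex permutation `π` (a list of `16` images): bit `v` of the
result is bit `π(v)` of the argument. -/
def pullBits (π bs : List ℕ) : List ℕ := π.map fun pv => bs.getD pv 0

/-- Composition of vertex permutations, `(p ∘ q)(v) = p (q v)`. -/
def compPerm (p q : List ℕ) : List ℕ := q.map fun v => p.getD v 0

/-- Evaluation of a generator word (letters `1`, `2`; each letter composes its generator on the
left). -/
def evalWord (w : List ℕ) : List ℕ :=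
  w.foldl (fun acc c => compPerm (gensTab.getD (c - 1) []) acc) (List.range 16)

/-- Bit lists of the representatives. -/
def repsBits : List (List ℕ) := repsKey.map bits

/-- Hamming distance of two vertex indices `< 16`. -/
def hamming (x y : ℕ) : ℕ := ((List.range 4).map fun j => (bit x j + bit y j) % 2).sum

/-- Add one to the `b`-th entry of a list of naturals. -/
def bump (l : List ℕ) (b : ℕ) : List ℕ := l.modify b (· + 1)

/-- Tabulated automorphism number `w` (block `w / 16`, entry `w % 16`). -/
def gtabAt (w : ℕ) : List ℕ := (gtab.getD (w / 16) []).getD (w % 16) []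

/-- Generator `i` (`i < 2`). -/
def genAt (i : ℕ) : List ℕ := gensTab.getD i []

/-- Words check, part 1: every tabulated automorphism is the value of its generator word. -/
def checkWordsEval : Bool := (List.range 384).all fun w => evalWord (wordsTab.getD w []) = gtabAt w

/-- Words check, part 2: each generator has length `16`, hits every vertex, and preserves the
Hamming distance of vertex indices (hence graph distance, in particular adjacency). -/
def checkGens : Bool :=
  (List.range 2).all fun i =>
    (genAt i).length = 16 &&
    ((List.range 16).all fun v => (List.range 16).any fun w => (genAt i).getD w 0 = v) &&
    ((List.range 16).all fun v => (List.range 16).all fun w =>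
      hamming ((genAt i).getD v 0) ((genAt i).getD w 0) = hamming v w)

/-- Words check, part 3: the letters of the words are `1` or `2`. -/
def checkLetters : Bool := (List.range 384).all fun w => (wordsTab.getD w []).all fun c => c = 1 || c = 2

/-- **Table check, words.** -/
def tableCheckWords : Bool := checkWordsEval && checkGens && checkLetters

/-- **Table check, keys of rank `lo ≤ r < hi`**: ranks are positions, every key is the pull-back
of its class representative along its witness, classes are invariant under the two generators,
and the class / witness indices are in range. -/
def tableCheckRange (lo hi : ℕ) : Bool :=
  ((keys8Bits.zipIdx.drop lo).take (hi - lo)).all fun p =>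
    let bs := p.1
    let e := entryAt p.2
    let c := e % 128
    let w := e / 128
    rankBits bs = p.2 && c < 74 && w < 384 &&
    pullBits (gtabAt w) (repsBits.getD c []) = bs &&
    clsBits (pullBits (genAt 0) bs) = c &&
    clsBits (pullBits (genAt 1) bs) = c

/-- Global check, part 1: `12 870` half-filled bit lists of length `16`. -/
def checkKeys : Bool :=
  (keys8Bits.length = 12870) && keys8Bits.all fun bs => bs.length = 16 && bs.sum = 8 && bs.all (· ≤ 1)

/-- Global check, part 2: `74` representatives, `< 2^16`, half filled, fixed by the class map. -/
def checkReps : Bool :=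
  (repsKey.length = 74) && (List.range 74).all fun a =>
    repsKey.getD a 0 < 65536 && (repsBits.getD a []).sum = 8 && clsBits (repsBits.getD a []) = a

/-- Global check, part 3: `orbitSize` lists the class multiplicities. -/
def checkSizes : Bool :=
  orbitSize = (List.range 12870).foldl (fun acc r => bump acc (entryAt r % 128)) (List.replicate 74 0)

/-- **Table check, global part.** -/
def tableCheckGlobal : Bool := checkKeys && checkReps && checkSizes

/-! ### Orbit algebra: the static tables recomputed -/

/-- The site of the `4 × 4` torus with Gray vertex index `v` (bit `j` of `v` = Gray bit `j`). -/
def vsite (v : ℕ) : TorusSite 2 4 := ungray fun j : Fin 4 => decide (bit v j.val = 1)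

/-- The Gray vertex index of a site. -/
def vidx (x : TorusSite 2 4) : ℕ :=
  (if gray x 0 then 1 else 0) + (if gray x 1 then 2 else 0) + (if gray x 2 then 4 else 0) +
    (if gray x 3 then 8 else 0)

/-- The `32` bonds of the `4 × 4` torus, each once, as ordered vertex pairs: the torus bonds
`(x, x + eᵢ)`, `i = 0, 1`, read through the vertex numbering. -/
def edgesQ4 : List (ℕ × ℕ) :=
  (List.range 16).flatMap fun v =>
    [(v, vidx (vsite v + Pi.single 0 1)), (v, vidx (vsite v + Pi.single 1 1))]

/-- Set position `v` of a bit list to `b`. -/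
def setBit (bs : List ℕ) (v b : ℕ) : List ℕ := bs.set v b

/-- Exchange the bits at `u` and `v`. -/
def swapBits (bs : List ℕ) (u v : ℕ) : List ℕ := setBit (setBit bs u (bs.getD v 0)) v (bs.getD u 0)

/-- The unequal-spin edges of representative `a` (the exchange edges). -/
def hopEdges (a : ℕ) : List (ℕ × ℕ) :=
  edgesQ4.filter fun e => (repsBits.getD a []).getD e.1 0 ≠ (repsBits.getD a []).getD e.2 0

/-- Classes reached from representative `a` by one exchange, edge by edge. -/
def hopTargets (a : ℕ) : List ℕ := (hopEdges a).map fun e => clsBits (swapBits (repsBits.getD a []) e.1 e.2)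

/-- Hop counts of representative `a`: multiplicities of `hopTargets a`. -/
def hopCount (a : ℕ) : List ℕ := (hopTargets a).foldl bump (List.replicate 74 0)

/-- `Σ_edges (+1 if equal spins, -1 if not)` at representative `a` (`= 4·Σ_⟨xy⟩ s_x s_y`). -/
def diagSum (a : ℕ) : ℤ :=
  (edgesQ4.map fun e =>
    if (repsBits.getD a []).getD e.1 0 = (repsBits.getD a []).getD e.2 0 then (1 : ℤ) else -1).sum

/-- Ordered vertex pairs `(x, y)`, `x ≠ y`, at Hamming distance `h`. -/
def pairsAt (h : ℕ) : List (ℕ × ℕ) :=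
  ((List.range 16).flatMap fun x => (List.range 16).map fun y => (x, y)).filter fun p =>
    p.1 ≠ p.2 && hamming p.1 p.2 = h

/-- The raise–lower moves of representative `a` at distance `h`: pairs `(x, y)` with `x` up (`0`)
and `y` down (`1`). -/
def rlMoves (h a : ℕ) : List (ℕ × ℕ) :=
  (pairsAt h).filter fun p => (repsBits.getD a []).getD p.1 1 = 0 && (repsBits.getD a []).getD p.2 0 = 1

/-- Classes reached from representative `a` by one raise–lower move at distance `h` (`x` down,
`y` up afterwards). -/
def rlTargets (h a : ℕ) : List ℕ :=
  (rlMoves h a).map fun p => clsBits (setBit (setBit (repsBits.getD a []) p.1 1) p.2 0)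

/-- Raise–lower counts of representative `a` at distance `h`: multiplicities of `rlTargets h a`. -/
def raiseLowerCount (h a : ℕ) : List ℕ := (rlTargets h a).foldl bump (List.replicate 74 0)

/-- **Static check, hop/diagonal tables**: the shipped tables are the recomputed ones, lengths are
`74`, and `n_a hop_ab = n_b hop_ba` (symmetry of the Hamiltonian in class coordinates). -/
def staticCheckHop : Bool :=
  ((List.range 74).all fun a => hopTab.getD a [] = hopCount a && (hopTab.getD a []).length = 74) &&
  ((List.range 74).all fun a => diag4.getD a 0 = diagSum a) && (diag4.length = 74) &&
  (hopTab.length = 74) && (orbitSize.length = 74) &&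
  ((List.range 74).all fun a => (List.range 74).all fun b =>
    orbitSize.getD a 0 * (hopTab.getD a []).getD b 0 = orbitSize.getD b 0 * (hopTab.getD b []).getD a 0)

/-- **Static check, raise–lower tables at distance `h`**: the shipped table is the recomputed one
and `n_a T_ab = n_b T_ba`. -/
def staticCheckT (h : ℕ) : Bool :=
  ((tTab h).length = 74) &&
  ((List.range 74).all fun a => (tTab h).getD a [] = raiseLowerCount h a && ((tTab h).getD a []).length = 74) &&
  ((List.range 74).all fun a => (List.range 74).all fun b =>
    orbitSize.getD a 0 * ((tTab h).getD a []).getD b 0 = orbitSize.getD b 0 * ((tTab h).getD b []).getD a 0)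

/-- **Static check, row sums of the raise–lower table**: `Σ_b T_ab ≤ 16·C(4,h)` (the number of
ordered site pairs at distance `h`), for the Schur bound `|⟪z, T_h z⟫ₙ| ≤ 16·C(4,h) ⟪z, z⟫ₙ`. -/
def rowCheckT (h : ℕ) : Bool :=
  (List.range 74).all fun a => decide (((tTab h).getD a []).sum ≤ 16 * Nat.choose 4 h)

end FourCert

end

end Summit.HubbardSuperconductivity.HubbardSuperconductivity.Theorems.LevyLogBootstrap
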